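import Summits.BirchSwinnertonDyer.BirchSwinnertonDyer.Theorems.ErratumRoadFiveNonSurjCornerKolyZShallow
import Summits.BirchSwinnertonDyer.BirchSwinnertonDyer.Theses.ErratumRoadFive

/-!
# BC3 skeleton v4 (candidate RESHAPE) — crux child `NonSurjCornerKolyZ` of `ErratumRoadFive.NonSurjCorner` (item stmt-BirchSwinnertonDyer-19946
# = `stub_kolyZ57` of the registered hybrid line `Cruxes/NonSurjCorner/Lines/hybrid.lean` r1′ of 19065) — seat `bsd-stepL-corner-p1` g14

Registered line of record: `Lines/birth.lean` (planner g30, d8b260a4): stubs `stub_kolyZ_5` ∕ `stub_kolyZ_7` = the child's text split by the prime.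
THIS RESHAPE isolates the child's honest open core using the seat's landed reduction `Theorems.nonSurjCornerKolyZ_of_deep` (p590794,
`Theorems/ErratumRoadFiveNonSurjCornerKolyZShallow.lean`): at every corner frame whose conductor-1 bottom Heegner point `y_K` is NOT
`p^{t+1}`-divisible in `E(K)` (`t = ord_p ∏ c_ℓ`) the conductor-1 certificate at depth `t` closes the child (KERNEL, modulo two named print
facts); what is left is the DEEP locus `y_K ∈ p^{t+1} E(K)` (by Gross–Zagier + BSD: the frames with `Ш(E/K)[p] ≠ 0` or `p ∣ c_Manin`), where a
DERIVED class must certify — Kolyvagin's conjecture proper in the refined form `𝓜_∞ ≤ Σ_ℓ ord_p c_ℓ` at a non-surjective irreducible image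
and `p ∥ N` (no print: BCGS 2026 Thm 2 needs (sur) and good `p`; Sweeting v3 Thm A needs `p ∤ N`; Castella 2024 Thm 1.3 needs a (ram) witness).
Stubs (2 ≤ stubs_max): `stub_kolyZ_deep_5` ∕ `stub_kolyZ_deep_7` — the child's registered text AT THE DEEP FRAMES ONLY (one extra binder),
split by the prime: OPEN (hardest). The two named print inputs of the shallow-frame argument (Darmon 2004 Thm. 3.6, Shimura reciprocity at
conductor 1) are THEOREMS of the tree (`phi_heegnerTau_mem_singularModuliField_holds`, `heegnerPointOfConductor_one_galoisConj_holds`) and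
need no stub (v3's `stub_kolyZ_inputs57` is gone).
Composition `NonSurjCornerKolyZ_of` has NO binder (audit rule of RULING 44: structured stubs are consumed BY NAME inside the proof) and concludes
the ROUTE decl `Theses.ErratumRoadFive.NonSurjCornerKolyZ` by `Theorems.nonSurjCornerKolyZ_of_deep'` (p591598). Sorries only in `stub_*`. Nothing is
asserted about any curve; the child is proved only modulo its stubs (T7). Offered as evidence + TURNKEY; registering it is the planner's call.
-/

set_option linter.dupNamespace false
set_option autoImplicit false

open scoped Classical NumberField

namespace Summit.BirchSwinnertonDyer.BirchSwinnertonDyer.Cruxes.NonSurjCornerKolyZ.BirthV4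

open Literature.NumberTheory.EllipticCurves Literature.NumberTheory.EllipticCurves.ModularForms
  Literature.NumberTheory.EllipticCurves.Rank1Residual Summit.BirchSwinnertonDyer.Rank1Residual
  Summit.BirchSwinnertonDyer.Rank1Residual.X11b.Three.Koly
  Summit.BirchSwinnertonDyer.BirchSwinnertonDyer.Theorems

/-- **stub deep (p = 5)**: refined-Kolyvagin certificates `∃ M ≤ t, CertificateAt Dt β ι 5 M` at the corner frames at `p = 5` (5S4 ∕ 5Ns images)
that are DEEP: some conductor-1 datum's bottom point, read in `E(K)`, lies in `5^{t+1} E(K)`, `t = ord_5 ∏ c_ℓ`. OPEN (Kolyvagin's conjecture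
proper, refined form, at a non-surjective irreducible image and `5 ∥ N`; a derived class `P_n`, `n ≠ 1`, must certify). -/
theorem stub_kolyZ_deep_5 :
    ∀ (W : WeierstrassCurve ℚ) [W.IsElliptic] [W.IsGloballyMinimal] [Fact (Nat.Prime 5)]
      (N : ℕ) [NeZero N] (K : Type) [Field K] [NumberField K]
      (Dt : ModularParametrizationData W N) (β : ℤ) (ι : K →+* ℂ),
      ClassX11b W 5 → ¬ Surj W 5 → 5 ∣ padicValInt 5 W.minimalDiscriminantInt →
      ¬ Ram W 5 → W.conductorNorm ℤ = N → IsImaginaryQuadratic K →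
      4 < (NumberField.discr K).natAbs → SatisfiesHeegnerHypothesis N K →
      SatisfiesHeegnerHypothesis 5 K → (4 * (N : ℤ)) ∣ β ^ 2 - NumberField.discr K → ¬ (5 : ℤ) ∣ Dt.c →
      (∃ (d₁ : KolyvaginHeegnerData Dt β ι 1) (y : (W.baseChange K).toAffine.Point),
        WeierstrassCurve.Affine.Point.map (W' := W) (algebraMap K (ringClassField K ι 1)).toRatAlgHom y =
          d₁.derivedPoint ∧
        ∃ Q : (W.baseChange K).toAffine.Point, ((5 ^ (padicValNat 5 W.tamagawaProduct + 1) : ℕ) : ℤ) • Q = y) →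
      ∃ M : ℕ, M ≤ padicValNat 5 W.tamagawaProduct ∧ CertificateAt Dt β ι 5 M := by
  sorry

/-- **stub deep (p = 7)**: the same at `p = 7` (7Ns images; members known only at N ≈ 10¹⁰ and beyond). OPEN. -/
theorem stub_kolyZ_deep_7 :
    ∀ (W : WeierstrassCurve ℚ) [W.IsElliptic] [W.IsGloballyMinimal] [Fact (Nat.Prime 7)]
      (N : ℕ) [NeZero N] (K : Type) [Field K] [NumberField K]
      (Dt : ModularParametrizationData W N) (β : ℤ) (ι : K →+* ℂ),
      ClassX11b W 7 → ¬ Surj W 7 → 7 ∣ padicValInt 7 W.minimalDiscriminantInt →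
      ¬ Ram W 7 → W.conductorNorm ℤ = N → IsImaginaryQuadratic K →
      4 < (NumberField.discr K).natAbs → SatisfiesHeegnerHypothesis N K →
      SatisfiesHeegnerHypothesis 7 K → (4 * (N : ℤ)) ∣ β ^ 2 - NumberField.discr K → ¬ (7 : ℤ) ∣ Dt.c →
      (∃ (d₁ : KolyvaginHeegnerData Dt β ι 1) (y : (W.baseChange K).toAffine.Point),
        WeierstrassCurve.Affine.Point.map (W' := W) (algebraMap K (ringClassField K ι 1)).toRatAlgHom y =
          d₁.derivedPoint ∧
        ∃ Q : (W.baseChange K).toAffine.Point, ((7 ^ (padicValNat 7 W.tamagawaProduct + 1) : ℕ) : ℤ) • Q = y) →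
      ∃ M : ℕ, M ≤ padicValNat 7 W.tamagawaProduct ∧ CertificateAt Dt β ι 7 M := by
  sorry

/-! ## The composition (sorry-free): the two stubs imply the crux child, BY NAME (route decl) -/

/-- **`NonSurjCornerKolyZ_of`** — no binder; the two deep stubs are consumed BY NAME inside the proof, through the seat's landed reduction
`Theorems.nonSurjCornerKolyZ_of_deep'` (shallow frames: conductor-1 certificate at depth `t`, named inputs discharged; deep frames: the stubs). -/
theorem NonSurjCornerKolyZ_of :
    Summit.BirchSwinnertonDyer.BirchSwinnertonDyer.Theses.ErratumRoadFive.NonSurjCornerKolyZ := by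
  show Summit.BirchSwinnertonDyer.BirchSwinnertonDyer.Theorems.NonSurjCornerKolyZ
  refine nonSurjCornerKolyZ_of_deep' ?_
  intro W _ _ p _ N _ K _ _ Dt β ι hX hns h57 hv hnr hN hK hd hHN hHp hβ hc hdeep
  rcases h57 with rfl | rfl
  · exact stub_kolyZ_deep_5 W N K Dt β ι hX hns hv hnr hN hK hd hHN hHp hβ hc hdeep
  · exact stub_kolyZ_deep_7 W N K Dt β ι hX hns hv hnr hN hK hd hHN hHp hβ hc hdeep

/-- The crux child along this line, MODULO exactly the two stubs (sorries only in open `stub_*`). -/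
theorem NonSurjCornerKolyZ_proof :
    Summit.BirchSwinnertonDyer.BirchSwinnertonDyer.Theses.ErratumRoadFive.NonSurjCornerKolyZ :=
  NonSurjCornerKolyZ_of

end Summit.BirchSwinnertonDyer.BirchSwinnertonDyer.Cruxes.NonSurjCornerKolyZ.BirthV4
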